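import Summits.BirchSwinnertonDyer.BirchSwinnertonDyer.Theorems.BiquadraticEisensteinDescentEisensteinHeartFlatCMInertBadKPrimeCharIdealBaseChange
import Summits.BirchSwinnertonDyer.BirchSwinnertonDyer.Theorems.ErratumRoadFiveFittingExtensionInequality
import Summits.BirchSwinnertonDyer.BirchSwinnertonDyer.Theorems.BiquadraticEisensteinDescentEisensteinHeartFlatCMInertBadKPrimeConstantScaling
import HarnessLib

set_option linter.dupNamespace false -- `Summit.BirchSwinnertonDyer.BirchSwinnertonDyer.Theorems.…` (summit = sub)
set_option autoImplicit false

/-!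
# Crux `EisensteinHeartFlatCMInertBadKPrime` (stmt-BirchSwinnertonDyer-21341), line `hsieh-lambda`, layer 2 (E1c), part 2:
# the (V3) socket WITH SLACK `p^{m′}` — comparison maps whose kernel or cokernel is killed by a power of `p`

Route `BiquadraticEisensteinDescent` (cell `pub/bsd-wall`, width-prover seat `bsd-wall-cm-bed-w1` g0, D-0152 M1). Sequel of
`…CharIdealBaseChange.lean` (p597280: flat base change cited, the `𝓞_{ℂ_p}⟦T⟧` reading, finite-(co)kernel transport).
Control/Shapiro comparisons are rarely pseudo-isomorphisms on the nose; when the obstruction is only `p`-power torsion the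
characteristic ideals still compare up to a power of `p`, which is exactly the hypothesis `hIJ : ∀ x ∈ I, C(p)^{m′}·x ∈ J`
of the lead's `…ConstantScaling.heartShape_of_pow_mul_le` / `heartShape_of_sockets`:

* `exists_pow_mem_charIdeal_of_smul_eq_zero` — over a Noetherian factorial domain, if `x` kills the finitely generated
  module `C` then `x^m ∈ Ch(C)` (`x^g ∈ Fitt₀(C) ⊆ Ch(C)`; tree `FittingExtension.pow_mem_fittingIdeal_zero_of_span_eq_top`,
  `SkinnerUrban2014.fittingIdeal_zero_le_charIdeal`);
* `exists_span_pow_mul_charIdeal_le_of_coker` / `…_of_ker` — `g : N → N′` with ANY kernel and `x`-torsion cokernel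
  (resp. `g′ : N′ → N` with `x`-torsion kernel and ANY cokernel) ⟹ `x^m·Ch(N) ⊆ Ch(N′)` (multiplicativity);
* `forall_C_pow_mul_mem_of_span_pow_mul_le`, `heartShape_of_coker_pTorsion`, `heartShape_of_ker_pTorsion` — the
  `𝓞_{ℂ_p}⟦T⟧` readings for `x = p^k` and `N ≅ M ⊗_Λ 𝒪⟦T⟧`, ending in the heart shape for `Ch_Λ(M)·𝓞_{ℂ_p}⟦T⟧`.

THEOREMS ONLY (no definition, no named fact, no `sorry`); imports no `Theses` module. Nothing about the crux's input or any
case of BSD is asserted; BSD is not proved by any of this. Supports stmt-BirchSwinnertonDyer-21341 as a helper.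
-/

noncomputable section

open scoped TensorProduct

open PowerSeries IsLocalRing
  Literature.NumberTheory.EllipticCurves Literature.NumberTheory.EllipticCurves.Module
  Summit.BirchSwinnertonDyer.Rank1Residual.X11b
  Summit.BirchSwinnertonDyer.BirchSwinnertonDyer.Theorems
  Summit.BirchSwinnertonDyer.BirchSwinnertonDyer.Theorems.BiquadraticEisensteinDescentEisensteinHeartFlatCMInertBadKPrimeCharIdealBaseChange

namespace Summit.BirchSwinnertonDyer.BirchSwinnertonDyer.Theorems.BiquadraticEisensteinDescentEisensteinHeartFlatCMInertBadKPrimeCharIdealSlack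

/-! ## The (V3) socket WITH SLACK `p^{m′}`: maps whose obstruction is killed by a power of `p`

Control/Shapiro comparisons are rarely pseudo-isomorphisms on the nose. If the comparison map has an
arbitrary kernel and a cokernel killed by `x` (resp. a kernel killed by `x` and an arbitrary cokernel), the
characteristic ideals still compare up to a power of `x`: `x^g ∈ Fitt₀ ⊆ Ch` of the obstruction (`g` generators;
tree `FittingExtension.pow_mem_fittingIdeal_zero_of_span_eq_top`, `SkinnerUrban2014.fittingIdeal_zero_le_charIdeal`)
and multiplicativity. Read in `𝓞_{ℂ_p}⟦T⟧` with `x = p^k` this is exactly the hypothesis `hIJ` of the lead's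
`…ConstantScaling.heartShape_of_pow_mul_le` / `heartShape_of_sockets`. -/

section Slack

variable {R : Type*} [CommRing R] [IsNoetherianRing R] [IsDomain R] [UniqueFactorizationMonoid R]
  {N N' : Type*} [AddCommGroup N] [Module R N] [AddCommGroup N'] [Module R N']

/-- **A power of an annihilating element lies in the characteristic ideal**: over a Noetherian factorial domain, if
`x` kills the finitely generated module `C` then `x^m ∈ Ch(C)` for some `m` (`x^g ∈ Fitt₀(C) ⊆ Ch(C)`, `g` = number
of generators). [cite: StacksProject, Tag 07ZA (2)] [cite: SkinnerUrban2014, §3.1.6 (p. 20)] -/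
theorem exists_pow_mem_charIdeal_of_smul_eq_zero (C : Type*) [AddCommGroup C] [Module R C] [Module.Finite R C]
    (x : R) (hx : ∀ c : C, x • c = 0) : ∃ m : ℕ, x ^ m ∈ charIdeal R C := by
  obtain ⟨n, y, hy⟩ := Module.Finite.exists_fin (R := R) (M := C)
  exact ⟨n, SkinnerUrban2014.fittingIdeal_zero_le_charIdeal
    (FittingExtension.pow_mem_fittingIdeal_zero_of_span_eq_top y hy hx)⟩

/-- **Slack socket, map towards the target**: `g : N → N′` with ANY kernel and cokernel killed by `x` (both modules
finitely generated torsion) ⟹ `x^m · Ch(N) ⊆ Ch(N′)` for some `m`: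
`Ch(N) = Ch(ker)·Ch(im) ⊆ Ch(im)`, `Ch(N′) = Ch(im)·Ch(coker) ∋ x^m·Ch(im)`.
[cite: NeukirchSchmidtWingberg2008, Ch. V §3, Remark 2 after (5.3.9)] [cite: StacksProject, Tag 07ZA (2)] -/
theorem exists_span_pow_mul_charIdeal_le_of_coker [Module.Finite R N] [Module.Finite R N']
    (hN : Module.IsTorsion R N) (hN' : Module.IsTorsion R N') (g : N →ₗ[R] N') (x : R)
    (hx : ∀ c : N' ⧸ LinearMap.range g, x • c = 0) :
    ∃ m : ℕ, Ideal.span {x ^ m} * charIdeal R N ≤ charIdeal R N' := by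
  obtain ⟨m, hm⟩ := exists_pow_mem_charIdeal_of_smul_eq_zero (N' ⧸ LinearMap.range g) x hx
  refine ⟨m, ?_⟩
  have h1 : charIdeal R N ≤ charIdeal R (LinearMap.range g) :=
    charIdeal_le_of_surjective hN g.rangeRestrict g.surjective_rangeRestrict
  have h2 : charIdeal R N' = charIdeal R (LinearMap.range g) * charIdeal R (N' ⧸ LinearMap.range g) :=
    charIdeal_eq_mul_of_exact hN' (LinearMap.range g).subtype (LinearMap.range g).mkQ
      (Submodule.subtype_injective _) (Submodule.mkQ_surjective _) (LinearMap.exact_subtype_mkQ _)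
  rw [h2, mul_comm]
  exact Ideal.mul_mono h1 ((Ideal.span_singleton_le_iff_mem _).mpr hm)

/-- **Slack socket, map from the target**: `g′ : N′ → N` with kernel killed by `x` and ANY cokernel (both modules
finitely generated torsion) ⟹ `x^m · Ch(N) ⊆ Ch(N′)` for some `m`:
`Ch(N) = Ch(im)·Ch(coker) ⊆ Ch(im)`, `Ch(N′) = Ch(ker)·Ch(im) ∋ x^m·Ch(im)`.
[cite: NeukirchSchmidtWingberg2008, Ch. V §3, Remark 2 after (5.3.9)] [cite: StacksProject, Tag 07ZA (2)] -/
theorem exists_span_pow_mul_charIdeal_le_of_ker [Module.Finite R N] [Module.Finite R N']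
    (hN : Module.IsTorsion R N) (hN' : Module.IsTorsion R N') (g' : N' →ₗ[R] N) (x : R)
    (hx : ∀ c : LinearMap.ker g', x • c = 0) :
    ∃ m : ℕ, Ideal.span {x ^ m} * charIdeal R N ≤ charIdeal R N' := by
  obtain ⟨m, hm⟩ := exists_pow_mem_charIdeal_of_smul_eq_zero (LinearMap.ker g') x hx
  refine ⟨m, ?_⟩
  have h1 : charIdeal R N ≤ charIdeal R (LinearMap.range g') :=
    charIdeal_le_of_injective hN (LinearMap.range g').subtype (Submodule.subtype_injective _)
  have h2 : charIdeal R N' = charIdeal R (LinearMap.ker g') * charIdeal R (LinearMap.range g') :=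
    charIdeal_eq_mul_of_exact hN' (LinearMap.ker g').subtype g'.rangeRestrict
      (Submodule.subtype_injective _) g'.surjective_rangeRestrict
      (LinearMap.exact_iff.mpr (by rw [LinearMap.ker_rangeRestrict, Submodule.range_subtype]))
  rw [h2]
  exact Ideal.mul_mono ((Ideal.span_singleton_le_iff_mem _).mpr hm) h1

end Slack

section SlackReading

variable {p : ℕ} [Fact p.Prime] {𝒪 : Type} [CommRing 𝒪] [IsDomain 𝒪] [IsDiscreteValuationRing 𝒪]
  [Algebra ℤ_[p] 𝒪] [Module.Free ℤ_[p] 𝒪] [Module.Finite ℤ_[p] 𝒪]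
  (ι : 𝒪 →+* 𝓞_ℂ_[p]) (hι : ι.comp (algebraMap ℤ_[p] 𝒪) = R1.toCpInt p)
  (M : Type*) [AddCommGroup M] [Module (IwasawaAlgebra p) M] [Module.Finite (IwasawaAlgebra p) M]
  {N : Type*} [AddCommGroup N] [Module (IwasawaAlgebra p) N] [Module 𝒪⟦X⟧ N]
  [IsScalarTower (IwasawaAlgebra p) 𝒪⟦X⟧ N] [Module.Finite 𝒪⟦X⟧ N]
  {N' : Type*} [AddCommGroup N'] [Module 𝒪⟦X⟧ N'] [Module.Finite 𝒪⟦X⟧ N']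

omit [IsDomain 𝒪] [IsDiscreteValuationRing 𝒪] [Algebra ℤ_[p] 𝒪] [Module.Free ℤ_[p] 𝒪]
  [Module.Finite ℤ_[p] 𝒪] in
/-- The coefficient map sends `p^k ∈ 𝒪⟦T⟧` to `C(p)^k ∈ 𝓞_{ℂ_p}⟦T⟧`. [folklore] -/
theorem map_natCast_pow (k : ℕ) :
    PowerSeries.map ι (((p : ℕ) : 𝒪⟦X⟧) ^ k) = (C ((p : ℕ) : 𝓞_ℂ_[p]) : PowerSeries 𝓞_ℂ_[p]) ^ k := by
  rw [map_pow, map_natCast, map_natCast]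

omit [Module.Finite 𝒪⟦X⟧ N] [Module.Finite 𝒪⟦X⟧ N'] in
include hι in
/-- **The (V3) socket with slack, read in `𝓞_{ℂ_p}⟦T⟧`**: from `x^m·Ch(N) ⊆ Ch(N′)` over `𝒪⟦T⟧` with `x = p^k`
and `N ≅ M ⊗_Λ 𝒪⟦T⟧`, the hypothesis `hIJ` of `…ConstantScaling.heartShape_of_pow_mul_le`:
`∀ y ∈ Ch_Λ(M)·𝓞_{ℂ_p}⟦T⟧, C(p)^{k m}·y ∈ Ch(N′)·𝓞_{ℂ_p}⟦T⟧`. [cite: StacksProject, Tag 02M1] -/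
theorem forall_C_pow_mul_mem_of_span_pow_mul_le (hM : Module.IsTorsion (IwasawaAlgebra p) M)
    {f : M →ₗ[IwasawaAlgebra p] N} (hf : IsBaseChange 𝒪⟦X⟧ f) {k m : ℕ}
    (h : Ideal.span {(((p : ℕ) : 𝒪⟦X⟧) ^ k) ^ m} * charIdeal 𝒪⟦X⟧ N ≤ charIdeal 𝒪⟦X⟧ N') :
    ∀ y ∈ (charIdeal (IwasawaAlgebra p) M).map (PowerSeries.map (R1.toCpInt p)),
      (C ((p : ℕ) : 𝓞_ℂ_[p]) : PowerSeries 𝓞_ℂ_[p]) ^ (k * m) * y ∈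
        (charIdeal 𝒪⟦X⟧ N').map (PowerSeries.map ι) := by
  intro y hy
  rw [map_toCpInt_charIdeal_eq_of_isBaseChange ι hι M hM hf] at hy
  have hle := Ideal.map_mono (f := PowerSeries.map ι) h
  rw [Ideal.map_mul, Ideal.map_span, Set.image_singleton, ← pow_mul, map_natCast_pow] at hle
  exact hle (Ideal.mul_mem_mul (Ideal.mem_span_singleton_self _) hy)

include hι in
/-- **Heart transfer with slack, cokernel form**: `g : N → N′` (`N ≅ M ⊗_Λ 𝒪⟦T⟧`, both finitely generated
torsion) with ANY kernel and cokernel killed by `p^k` ⟹ the heart shape for `(Ch(N′)·𝓞_{ℂ_p}⟦T⟧, Q)` gives the heart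
shape for `(Ch_Λ(M)·𝓞_{ℂ_p}⟦T⟧, Q)`. [cite: NeukirchSchmidtWingberg2008, Ch. V §3, Remark 2 after (5.3.9)] -/
theorem heartShape_of_coker_pTorsion (hM : Module.IsTorsion (IwasawaAlgebra p) M)
    {f : M →ₗ[IwasawaAlgebra p] N} (hf : IsBaseChange 𝒪⟦X⟧ f) (hN : Module.IsTorsion 𝒪⟦X⟧ N)
    (hN' : Module.IsTorsion 𝒪⟦X⟧ N') (g : N →ₗ[𝒪⟦X⟧] N') {k : ℕ}
    (hk : ∀ c : N' ⧸ LinearMap.range g, (((p : ℕ) : 𝒪⟦X⟧) ^ k) • c = 0) {Q : PowerSeries 𝓞_ℂ_[p]}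
    (hN'Q : ∃ m : ℕ, ∀ x ∈ (charIdeal 𝒪⟦X⟧ N').map (PowerSeries.map ι),
      (C ((p : ℕ) : 𝓞_ℂ_[p]) : PowerSeries 𝓞_ℂ_[p]) ^ m * x ∈ Ideal.span {Q}) :
    ∃ m : ℕ, ∀ x ∈ (charIdeal (IwasawaAlgebra p) M).map (PowerSeries.map (R1.toCpInt p)),
      (C ((p : ℕ) : 𝓞_ℂ_[p]) : PowerSeries 𝓞_ℂ_[p]) ^ m * x ∈ Ideal.span {Q} := by
  obtain ⟨m, hm⟩ := exists_span_pow_mul_charIdeal_le_of_coker hN hN' g _ hk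
  exact BiquadraticEisensteinDescentEisensteinHeartFlatCMInertBadKPrimeConstantScaling.heartShape_of_pow_mul_le
    (forall_C_pow_mul_mem_of_span_pow_mul_le ι hι M hM hf hm) hN'Q

include hι in
/-- **Heart transfer with slack, kernel form**: `g′ : N′ → N` with kernel killed by `p^k` and ANY cokernel ⟹ the heart
shape for `(Ch(N′)·𝓞_{ℂ_p}⟦T⟧, Q)` gives the heart shape for `(Ch_Λ(M)·𝓞_{ℂ_p}⟦T⟧, Q)`.
[cite: NeukirchSchmidtWingberg2008, Ch. V §3, Remark 2 after (5.3.9)] -/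
theorem heartShape_of_ker_pTorsion (hM : Module.IsTorsion (IwasawaAlgebra p) M)
    {f : M →ₗ[IwasawaAlgebra p] N} (hf : IsBaseChange 𝒪⟦X⟧ f) (hN : Module.IsTorsion 𝒪⟦X⟧ N)
    (hN' : Module.IsTorsion 𝒪⟦X⟧ N') (g' : N' →ₗ[𝒪⟦X⟧] N) {k : ℕ}
    (hk : ∀ c : LinearMap.ker g', (((p : ℕ) : 𝒪⟦X⟧) ^ k) • c = 0) {Q : PowerSeries 𝓞_ℂ_[p]}
    (hN'Q : ∃ m : ℕ, ∀ x ∈ (charIdeal 𝒪⟦X⟧ N').map (PowerSeries.map ι),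
      (C ((p : ℕ) : 𝓞_ℂ_[p]) : PowerSeries 𝓞_ℂ_[p]) ^ m * x ∈ Ideal.span {Q}) :
    ∃ m : ℕ, ∀ x ∈ (charIdeal (IwasawaAlgebra p) M).map (PowerSeries.map (R1.toCpInt p)),
      (C ((p : ℕ) : 𝓞_ℂ_[p]) : PowerSeries 𝓞_ℂ_[p]) ^ m * x ∈ Ideal.span {Q} := by
  obtain ⟨m, hm⟩ := exists_span_pow_mul_charIdeal_le_of_ker hN hN' g' _ hk
  exact BiquadraticEisensteinDescentEisensteinHeartFlatCMInertBadKPrimeConstantScaling.heartShape_of_pow_mul_le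
    (forall_C_pow_mul_mem_of_span_pow_mul_le ι hι M hM hf hm) hN'Q

end SlackReading

/-! ## (appended, same seat) Torsion passes to the base change — discharging `hN` of the sockets

The slack sockets ask that the consumer's model `N ≅ M ⊗_Λ 𝒪⟦T⟧` be `𝒪⟦T⟧`-torsion; this is automatic from
`M` torsion (flat, indeed free, coefficient extension), so the `hN`-free forms below take only the heart's own
hypotheses on `M` and the consumer's on the CM-side module `N′`. -/

section TorsionBaseChange

variable {R S : Type*} [CommRing R] [CommRing S] [Algebra R S] [IsDomain S] [Module.Flat R S]
  {M : Type*} [AddCommGroup M] [Module R M] [Module.Finite R M]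

/-- **A finitely generated torsion module stays torsion after a flat base change to a domain**: one
non-zero-divisor `s` kills `M` (`Submodule.annihilator_top_inter_nonZeroDivisors`), its image is non-zero by
flatness (tree `PlusMCEtaKCharIdealBaseChange.algebraMap_ne_zero_of_flat`) and kills `S ⊗_R M`. [folklore] -/
theorem isTorsion_baseChange (hM : Module.IsTorsion R M) : Module.IsTorsion S (S ⊗[R] M) := by
  obtain ⟨s, hsann, hs0⟩ := Submodule.annihilator_top_inter_nonZeroDivisors hM
  have hsM : ∀ m : M, s • m = 0 := fun m => Submodule.mem_annihilator.mp hsann m Submodule.mem_top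
  have hs : algebraMap R S s ≠ 0 := PlusMCEtaKCharIdealBaseChange.algebraMap_ne_zero_of_flat hs0
  intro x
  refine ⟨⟨algebraMap R S s, mem_nonZeroDivisors_of_ne_zero hs⟩, ?_⟩
  show algebraMap R S s • x = 0
  induction x using TensorProduct.induction_on with
  | zero => rw [smul_zero]
  | tmul a m =>
    rw [TensorProduct.smul_tmul', algebraMap_smul, TensorProduct.smul_tmul, hsM m, TensorProduct.tmul_zero]
  | add x y hx hy => rw [smul_add, hx, hy, add_zero]

variable {N : Type*} [AddCommGroup N] [Module R N] [Module S N] [IsScalarTower R S N]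

/-- The same for any base-change datum `f : M → N` (`IsBaseChange S f`). [folklore] -/
theorem isTorsion_of_isBaseChange (hM : Module.IsTorsion R M) {f : M →ₗ[R] N} (hf : IsBaseChange S f) :
    Module.IsTorsion S N := by
  have h := isTorsion_baseChange (S := S) hM
  intro x
  obtain ⟨a, ha⟩ := @h (hf.equiv.symm x)
  refine ⟨a, ?_⟩
  have := congrArg hf.equiv ha
  rwa [map_zero, Submonoid.smul_def, map_smul, LinearEquiv.apply_symm_apply] at this

end TorsionBaseChange

section SlackReadingFree

variable {p : ℕ} [Fact p.Prime] {𝒪 : Type} [CommRing 𝒪] [IsDomain 𝒪] [IsDiscreteValuationRing 𝒪]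
  [Algebra ℤ_[p] 𝒪] [Module.Free ℤ_[p] 𝒪] [Module.Finite ℤ_[p] 𝒪]
  (ι : 𝒪 →+* 𝓞_ℂ_[p]) (hι : ι.comp (algebraMap ℤ_[p] 𝒪) = R1.toCpInt p)
  (M : Type*) [AddCommGroup M] [Module (IwasawaAlgebra p) M] [Module.Finite (IwasawaAlgebra p) M]
  {N : Type*} [AddCommGroup N] [Module (IwasawaAlgebra p) N] [Module 𝒪⟦X⟧ N]
  [IsScalarTower (IwasawaAlgebra p) 𝒪⟦X⟧ N] [Module.Finite 𝒪⟦X⟧ N]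
  {N' : Type*} [AddCommGroup N'] [Module 𝒪⟦X⟧ N'] [Module.Finite 𝒪⟦X⟧ N']

include hι in
/-- **Heart transfer with slack, cokernel form, `hN`-free**: as `heartShape_of_coker_pTorsion`, the torsion of the
model `N ≅ M ⊗_Λ 𝒪⟦T⟧` being derived from that of `M` (`isTorsion_of_isBaseChange`; `𝒪⟦T⟧` is free over `Λ`,
tree `PlusMCEtaKBaseChange.free_powerSeries`). [cite: NeukirchSchmidtWingberg2008, Ch. V §3, Remark 2 after (5.3.9)] -/
theorem heartShape_of_coker_pTorsion₀ (hM : Module.IsTorsion (IwasawaAlgebra p) M)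
    {f : M →ₗ[IwasawaAlgebra p] N} (hf : IsBaseChange 𝒪⟦X⟧ f) (hN' : Module.IsTorsion 𝒪⟦X⟧ N')
    (g : N →ₗ[𝒪⟦X⟧] N') {k : ℕ} (hk : ∀ c : N' ⧸ LinearMap.range g, (((p : ℕ) : 𝒪⟦X⟧) ^ k) • c = 0)
    {Q : PowerSeries 𝓞_ℂ_[p]}
    (hN'Q : ∃ m : ℕ, ∀ x ∈ (charIdeal 𝒪⟦X⟧ N').map (PowerSeries.map ι),
      (C ((p : ℕ) : 𝓞_ℂ_[p]) : PowerSeries 𝓞_ℂ_[p]) ^ m * x ∈ Ideal.span {Q}) :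
    ∃ m : ℕ, ∀ x ∈ (charIdeal (IwasawaAlgebra p) M).map (PowerSeries.map (R1.toCpInt p)),
      (C ((p : ℕ) : 𝓞_ℂ_[p]) : PowerSeries 𝓞_ℂ_[p]) ^ m * x ∈ Ideal.span {Q} := by
  haveI : Module.Free (IwasawaAlgebra p) 𝒪⟦X⟧ := PlusMCEtaKBaseChange.free_powerSeries
  exact heartShape_of_coker_pTorsion ι hι M hM hf (isTorsion_of_isBaseChange hM hf) hN' g hk hN'Q

include hι in
/-- **Heart transfer with slack, kernel form, `hN`-free**: as `heartShape_of_ker_pTorsion`, with the torsion of `N`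
derived from that of `M`. [cite: NeukirchSchmidtWingberg2008, Ch. V §3, Remark 2 after (5.3.9)] -/
theorem heartShape_of_ker_pTorsion₀ (hM : Module.IsTorsion (IwasawaAlgebra p) M)
    {f : M →ₗ[IwasawaAlgebra p] N} (hf : IsBaseChange 𝒪⟦X⟧ f) (hN' : Module.IsTorsion 𝒪⟦X⟧ N')
    (g' : N' →ₗ[𝒪⟦X⟧] N) {k : ℕ} (hk : ∀ c : LinearMap.ker g', (((p : ℕ) : 𝒪⟦X⟧) ^ k) • c = 0)
    {Q : PowerSeries 𝓞_ℂ_[p]}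
    (hN'Q : ∃ m : ℕ, ∀ x ∈ (charIdeal 𝒪⟦X⟧ N').map (PowerSeries.map ι),
      (C ((p : ℕ) : 𝓞_ℂ_[p]) : PowerSeries 𝓞_ℂ_[p]) ^ m * x ∈ Ideal.span {Q}) :
    ∃ m : ℕ, ∀ x ∈ (charIdeal (IwasawaAlgebra p) M).map (PowerSeries.map (R1.toCpInt p)),
      (C ((p : ℕ) : 𝓞_ℂ_[p]) : PowerSeries 𝓞_ℂ_[p]) ^ m * x ∈ Ideal.span {Q} := by
  haveI : Module.Free (IwasawaAlgebra p) 𝒪⟦X⟧ := PlusMCEtaKBaseChange.free_powerSeries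
  exact heartShape_of_ker_pTorsion ι hι M hM hf (isTorsion_of_isBaseChange hM hf) hN' g' hk hN'Q

omit [Module.Finite 𝒪⟦X⟧ N'] in
include hι in
/-- **Heart transfer, surjection form, `hN`-free**: `g : N ↠ N′` with `N ≅ M ⊗_Λ 𝒪⟦T⟧` (no hypothesis on the kernel,
no slack needed): the `…CharIdealBaseChange.heartShape_of_surjective` with `hN` discharged.
[cite: NeukirchSchmidtWingberg2008, Ch. V §3, Remark 2 after (5.3.9)] -/
theorem heartShape_of_surjective₀ (hM : Module.IsTorsion (IwasawaAlgebra p) M)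
    {f : M →ₗ[IwasawaAlgebra p] N} (hf : IsBaseChange 𝒪⟦X⟧ f) (g : N →ₗ[𝒪⟦X⟧] N')
    (hg : Function.Surjective g) {Q : PowerSeries 𝓞_ℂ_[p]}
    (hN'Q : ∃ m : ℕ, ∀ x ∈ (charIdeal 𝒪⟦X⟧ N').map (PowerSeries.map ι),
      (C ((p : ℕ) : 𝓞_ℂ_[p]) : PowerSeries 𝓞_ℂ_[p]) ^ m * x ∈ Ideal.span {Q}) :
    ∃ m : ℕ, ∀ x ∈ (charIdeal (IwasawaAlgebra p) M).map (PowerSeries.map (R1.toCpInt p)),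
      (C ((p : ℕ) : 𝓞_ℂ_[p]) : PowerSeries 𝓞_ℂ_[p]) ^ m * x ∈ Ideal.span {Q} := by
  haveI : Module.Free (IwasawaAlgebra p) 𝒪⟦X⟧ := PlusMCEtaKBaseChange.free_powerSeries
  exact heartShape_of_surjective ι hι M hM hf (isTorsion_of_isBaseChange hM hf) g hg hN'Q

end SlackReadingFree

end Summit.BirchSwinnertonDyer.BirchSwinnertonDyer.Theorems.BiquadraticEisensteinDescentEisensteinHeartFlatCMInertBadKPrimeCharIdealSlack

end
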